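import Summits.BirchSwinnertonDyer.BirchSwinnertonDyer.Theorems.SignedLowerHalvesSprungLowerDivisibilityAtThreeCokerBoundByMassContraPoitouTate
import Summits.BirchSwinnertonDyer.BirchSwinnertonDyer.Theorems.SignedLowerHalvesSprungLowerDivisibilityAtThreeBothColours
import Literature.NumberTheory.EllipticCurves.Sprung2012.SharpFlatSelmerDualRestrictionProofs
import HarnessLib

/-!
# Crux `SprungLowerDivisibilityAtThree` (item stmt-BirchSwinnertonDyer-19875; keying-honest child 23401
# `KatoSporadicPosLevelGivenHeldX8C`, children 22569 / 22901 / 22570), line `chromatic-common-zeros`: F-α♮'s fourth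
# named fact `Kato2004_fineSelmerDual_isTorsion` REPLACED by the route's own guard Sprung Thm. 7.14 —
# `X₀(E/ℚ_∞)` is `Λ`-torsion on class X8 because it is a quotient of the torsion module `X^♯(E/ℚ_∞)`

Cell `bsd-ssimc` (host), width seat `cruxlead-stmt-BirchSwinnertonDyer-19875-w2` (gen 10) under the 19875 LEAD;
`--supports stmt-BirchSwinnertonDyer-23401 --as helper`; THEOREMS ONLY; closes NO item. Answers the LEAD's L4 finding
(bus 2026-08-28T21:37:08Z): the registered input-free stub `stub_cokerBoundIotaOffT` (F-α♮) was derived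
(`cokerBoundIotaOffT_of_poitouTate'`, w2 g9 / w3 g9) modulo FOUR named facts none of which is a guard of 23401 —
`Sprung2012.thm714seq_sharpFlat_poitouTate_functionalModel`, `Kato2004.thm12_4`,
`matar2020_thm11_selmerDualTorsion_pseudoIso_fineSelmerDual`, `Kato2004_fineSelmerDual_isTorsion`. The LAST one is used only
to know that the fine dual `X₀(E/ℚ_∞)` at the X8 pair is `Λ`-torsion (finite local lengths; Matar's hypothesis). On class X8,
inside the stub's own frame (newform `f`, Sprung pair, Honda system), that is a CONSEQUENCE of the guard
`thm714_sharpFlatSelmerDual_finite_torsion` (Sprung 2012 Thm. 1.2 / 7.14, item 23402's `h714`): `L♯ ≠ 0` on X8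
(`ChromaticBothColours.ClassX8.chromaticL_ne_zero`, a tree theorem), so `X♯` is torsion by Thm. 7.14, and `Sel₀ ≤ Sel♯` gives a
`Λ`-linear SURJECTION `X♯ ↠ X₀` (`Sprung2012.SharpFlatSelmerDualData.exists_linearMap_toFineDual'`, w3 g9 p670447), whose
target is therefore torsion.

* §1 `isTorsion_of_surjective` (plumbing), **`fineSelmerDualData_isTorsion_of_thm714`**: on class X8, in the cyclotomic /
  Honda / newform / Sprung-pair frame, EVERY `Y : W.FineSelmerDualData κ γ` has `Λ`-torsion `Y.X`, GRANTED `h714` only;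
  `…_inv_of_thm714`: the same for the `γ⁻¹`-keyed (contragredient = print-keyed) fine data (torsion is keying-immune,
  `Sprung2012.fineSelmerDualData_isTorsion_inv_iff`).
* §2 `lengthAt_torsion_selmerDual_eq_fine_comap_invol_of_matar_of_isTorsion` — w2 g9's Wingberg/Matar reading (M2)
  `ℓ_𝔭(tors X(E/ℚ_∞)) = ℓ_{ι𝔭}(X₀)` with the torsion of `X₀` DISPLAYED per instance instead of the global named fact.
* §3 **`cokerBoundIotaOffT_of_poitouTate_of_thm714 (hPT) (h124) (hMatar) (h714)`** = THE REGISTERED STUB SIGNATURE of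
  `stub_cokerBoundIotaOffT` (23401 / 22569 / 22901 / 22570), VERBATIM, from THREE outside named facts + the route's guard
  `h714` — one fact fewer than `cokerBoundIotaOffT_of_poitouTate'`.

Trust base after this file for F-α♮ on 23401: {Poitou–Tate functional model (Sprung (3) + Kobayashi 7.1/7.3, typed w3 g9),
Kato Thm. 12.4 (3), Matar 2020 Thm. 1.1} outside the guards, + `h714` inside. BSD, K1 `SprungLowerDivisibilityAtThree`, K_spor,
the residue R♮ and those three facts are NOT proved here; nothing is asserted beyond implications between typed statements.
-/

-- the single-conjunct summit namespace `Summit.BirchSwinnertonDyer.BirchSwinnertonDyer` repeats by design (D-0017)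
set_option linter.dupNamespace false
set_option autoImplicit false

noncomputable section

open scoped Classical NumberField MatrixGroups ModularForm

open NumberField IsDedekindDomain CongruenceSubgroup WeierstrassCurve Field
  Literature.NumberTheory.EllipticCurves Literature.NumberTheory.EllipticCurves.ModularForms
  Literature.NumberTheory.EllipticCurves.ZpExtension Literature.NumberTheory.EllipticCurves.Sprung2017
  Literature.NumberTheory.EllipticCurves.Sprung2012 Literature.NumberTheory.EllipticCurves.Rank1Residual
  Literature.NumberTheory.EllipticCurves.IwasawaAlgebra Literature.NumberTheory.EllipticCurves.Kato2004
  Literature.NumberTheory.EllipticCurves.Module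

namespace Summit.BirchSwinnertonDyer.BirchSwinnertonDyer.Theorems.ChromaticCommonZeros

/-! ### §1 `X₀(E/ℚ_∞)` is `Λ`-torsion on class X8, granted Sprung Thm. 7.14 (`h714`) -/

section Torsion

/-- Torsion passes to the target of a surjective linear map (plumbing). -/
theorem isTorsion_of_surjective {R : Type*} [CommRing R] {M N : Type*} [AddCommGroup M] [Module R M]
    [AddCommGroup N] [Module R N] (k : M →ₗ[R] N) (hk : Function.Surjective k) (hM : Module.IsTorsion R M) :
    Module.IsTorsion R N := by
  intro y
  obtain ⟨x, rfl⟩ := hk y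
  obtain ⟨a, ha⟩ := @hM x
  refine ⟨a, ?_⟩
  have ha' : (a : R) • x = 0 := ha
  show (a : R) • k x = 0
  rw [← map_smul, ha', map_zero]

/-- **`X₀(E/ℚ_∞)` is `Λ`-torsion on class X8, from Sprung's Thm. 7.14 alone.** In the frame of the crux's stubs — `W` on class X8
(`p = 3` good supersingular, `3 ∣ a₃ ≠ 0`), cyclotomic `κ` with topological generator `γ` (a cyclotomic variable), the place
`v ∋ p`, a local topological generator `g`, a Honda system `(c₋, c)`, the newform `f` of `W` and a Sprung pair `(L♯, L♭)` — every
Pontryagin-dual datum `Y` of `Sel₀(E/ℚ_∞)` (key `γ`) has torsion `Y.X`, GRANTED the named fact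
`thm714_sharpFlatSelmerDual_finite_torsion` (guard `h714` of item 23402): `L♯ ≠ 0` on X8 (tree theorem), so a dual datum `D` of
`Sel♯` (which exists, `nonempty_sharpFlatSelmerDualData'`) is torsion by Thm. 7.14, and `X♯ ↠ X₀` (`exists_linearMap_toFineDual'`). -/
theorem fineSelmerDualData_isTorsion_of_thm714 (h714 : thm714_sharpFlatSelmerDual_finite_torsion)
    (W : WeierstrassCurve ℚ) [W.IsElliptic] [W.IsGloballyMinimal] (p : ℕ) [Fact p.Prime] (hX : ClassX8 W p)
    {κ : ZpExtension ℚ p} {γ : Field.absoluteGaloisGroup ℚ} (hκ : κ.IsCyclotomic) (hγ : κ.IsTopGenerator γ)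
    (hcv : IsCyclotomicVariable p γ) {v : HeightOneSpectrum (𝓞 ℚ)} (hv : (p : 𝓞 ℚ) ∈ v.asIdeal)
    {g : Field.absoluteGaloisGroup (v.adicCompletion ℚ)}
    (hg : κ.IsTopGenerator (resGalOfEmb (closureEmb (K := ℚ) (v.adicCompletion ℚ)) g))
    {cneg : localPoints W (v.adicCompletion ℚ)} {c : ℕ → localPoints W (v.adicCompletion ℚ)}
    (hH : IsHondaSystem κ (closureEmb (K := ℚ) (v.adicCompletion ℚ)) W (W.frobeniusTrace p) g cneg c)
    {N : ℕ} [NeZero N] {f : CuspForm (Gamma0 N) 2} (hf : IsNewformOf W f) {Lsharp Lflat : IwasawaAlgebra p}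
    (hSP : IsSprungPair f p (W.frobeniusTrace p) Lsharp Lflat) (Y : W.FineSelmerDualData κ γ) :
    Module.IsTorsion (IwasawaAlgebra p) Y.X := by
  have hX' := hX
  obtain ⟨hp3, ⟨hgood, hss⟩, -⟩ := hX'
  subst hp3
  have hne : chromaticL Chroma.sharp Lsharp Lflat ≠ 0 :=
    ChromaticBothColours.ClassX8.chromaticL_ne_zero W 3 hX f Lsharp Lflat hf hSP Chroma.sharp
  obtain ⟨D⟩ := nonempty_sharpFlatSelmerDualData' W κ (closureEmb (K := ℚ) (v.adicCompletion ℚ))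
    (W.frobeniusTrace 3) g c Chroma.sharp γ
  have hD : Module.IsTorsion (IwasawaAlgebra 3) D.X :=
    (h714 W 3 (by decide) hgood hss f hf κ γ hκ hγ hcv v hv g hg cneg c hH Chroma.sharp Lsharp Lflat hSP hne D).2
  obtain ⟨k, hk, -⟩ := SharpFlatSelmerDualData.exists_linearMap_toFineDual' (D := D) (Y := Y)
  exact isTorsion_of_surjective k hk hD

/-- The same for the CONTRAGREDIENT (print-keyed, key `γ⁻¹`) fine data `Y′ : W.FineSelmerDualData κ γ⁻¹`: torsion-ness is
keying-immune (`fineSelmerDualData_isTorsion_inv_iff`). GRANTED `h714` only. -/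
theorem fineSelmerDualData_isTorsion_inv_of_thm714 (h714 : thm714_sharpFlatSelmerDual_finite_torsion)
    (W : WeierstrassCurve ℚ) [W.IsElliptic] [W.IsGloballyMinimal] (p : ℕ) [Fact p.Prime] (hX : ClassX8 W p)
    {κ : ZpExtension ℚ p} {γ : Field.absoluteGaloisGroup ℚ} (hκ : κ.IsCyclotomic) (hγ : κ.IsTopGenerator γ)
    (hcv : IsCyclotomicVariable p γ) {v : HeightOneSpectrum (𝓞 ℚ)} (hv : (p : 𝓞 ℚ) ∈ v.asIdeal)
    {g : Field.absoluteGaloisGroup (v.adicCompletion ℚ)}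
    (hg : κ.IsTopGenerator (resGalOfEmb (closureEmb (K := ℚ) (v.adicCompletion ℚ)) g))
    {cneg : localPoints W (v.adicCompletion ℚ)} {c : ℕ → localPoints W (v.adicCompletion ℚ)}
    (hH : IsHondaSystem κ (closureEmb (K := ℚ) (v.adicCompletion ℚ)) W (W.frobeniusTrace p) g cneg c)
    {N : ℕ} [NeZero N] {f : CuspForm (Gamma0 N) 2} (hf : IsNewformOf W f) {Lsharp Lflat : IwasawaAlgebra p}
    (hSP : IsSprungPair f p (W.frobeniusTrace p) Lsharp Lflat) (Y' : W.FineSelmerDualData κ γ⁻¹) :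
    Module.IsTorsion (IwasawaAlgebra p) Y'.X := by
  obtain ⟨Y, e, he, -⟩ := Kato2004.fineSelmerDualData_exists_involTwist (inv_mul_cancel γ) Y'
  -- `e : Y'.X ≃+ Y.X` is `ι`-semilinear; torsion of `Y.X` (§1 at key `γ`) pulls back along `e`
  have hY := fineSelmerDualData_isTorsion_of_thm714 h714 W p hX hκ hγ hcv hv hg hH hf hSP Y
  intro m
  obtain ⟨⟨a, ha⟩, ham⟩ := @hY (e m)
  have ha0 : invol p a ≠ 0 := fun h0 ↦
    nonZeroDivisors.ne_zero ha (invol_injective p (by rw [h0, map_zero]))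
  refine ⟨⟨invol p a, mem_nonZeroDivisors_of_ne_zero ha0⟩, e.injective ?_⟩
  change e (invol p a • m) = e 0
  rw [he, invol_invol, map_zero]
  exact ham

end Torsion

/-! ### §2 (M2) at one prime with the torsion of `X₀` displayed -/

section Matar

/-- **Wingberg/Matar at one prime, torsion displayed**: for `E/ℚ`, `p ≠ 2` good supersingular, cyclotomic `κ`/`γ`, any
`S : W.SelmerDualData κ γ` and any fine datum `Y` (same key) WITH `Y.X` torsion, at every prime `𝔭` of height `≤ 1`:
`ℓ_𝔭(tors_Λ S.X) = ℓ_{ι𝔭}(Y.X)` — w2 g9's `lengthAt_torsion_selmerDual_eq_fine_comap_invol_of_matar` with the global fact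
`Kato2004_fineSelmerDual_isTorsion` replaced by the per-instance hypothesis `hYt`. CONDITIONAL on Matar's named fact only. -/
theorem lengthAt_torsion_selmerDual_eq_fine_comap_invol_of_matar_of_isTorsion
    (hMatar : matar2020_thm11_selmerDualTorsion_pseudoIso_fineSelmerDual)
    (W : WeierstrassCurve ℚ) [W.IsElliptic] [W.IsGloballyMinimal] (p : ℕ) [Fact p.Prime] (hp : p ≠ 2)
    (hgood : W.HasGoodReductionAtPrime p) (hss : (p : ℤ) ∣ W.frobeniusTrace p)
    {κ : ZpExtension ℚ p} {γ : Field.absoluteGaloisGroup ℚ} (hκ : κ.IsCyclotomic) (hγ : κ.IsTopGenerator γ)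
    (S : W.SelmerDualData κ γ) (Y : W.FineSelmerDualData κ γ) (hYt : Module.IsTorsion (IwasawaAlgebra p) Y.X)
    (𝔭 : PrimeSpectrum (IwasawaAlgebra p)) (h𝔭 : 𝔭.asIdeal.height ≤ 1) :
    Module.lengthAt (IwasawaAlgebra p) (Submodule.torsion (IwasawaAlgebra p) S.X) 𝔭 =
      Module.lengthAt (IwasawaAlgebra p) Y.X (PrimeSpectrum.comap (invol p).toRingHom 𝔭) := by
  obtain ⟨Y', e, he, -⟩ := Kato2004.fineSelmerDualData_exists_involTwist (mul_inv_cancel γ) Y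
  have hY't : Module.IsTorsion (IwasawaAlgebra p) Y'.X := Kato2004.isTorsion_of_involSemilinear hYt e he
  obtain ⟨φ, hφ⟩ := hMatar W p κ γ γ⁻¹ hp hgood hss hκ hγ (mul_inv_cancel γ) S Y' hY't
  rw [lengthAt_eq_of_isPseudoIsomorphism hφ 𝔭 h𝔭, Kato2004.fineSelmerDualData_lengthAt_inv_eq Y Y' 𝔭]

end Matar

/-! ### §3 THE REGISTERED STUB F-α♮ from three outside facts + the guard `h714` -/

section Stub

/-- **F-α♮ — the registered stub `stub_cokerBoundIotaOffT` (23401 / 22569 / 22901 / 22570), SIGNATURE VERBATIM, from THREE named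
printed facts outside the route's guards — Poitou–Tate in the functional model (`thm714seq_sharpFlat_poitouTate_functionalModel`),
Kato Thm. 12.4 (`Kato2004.thm12_4`), Matar 2020 Thm. 1.1 (`matar2020_thm11_selmerDualTorsion_pseudoIso_fineSelmerDual`) — AND
the guard `h714` (Sprung Thm. 7.14) in place of `Kato2004_fineSelmerDual_isTorsion`.** Proof: inside the stub's frame the fine
datum `Y` is torsion by §1; (M1) = `massCotorsion_of_poitouTate hPT h124 nonempty_iwasawaH1Data_holds`; (M2) = §2; dual data of
both colours exist; cancel `ℓ_𝔭 Y.X < ⊤` (`min_lengthAt_cokernel_le_of_mass`). So on 23401 the LEAD may write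
`stub_cokerBoundIotaOffT := cokerBoundIotaOffT_of_poitouTate_of_thm714 hPT h124 hMatar h714` with `h714` taken from the held pack. -/
theorem cokerBoundIotaOffT_of_poitouTate_of_thm714 (hPT : thm714seq_sharpFlat_poitouTate_functionalModel)
    (h124 : Kato2004.thm12_4) (hMatar : matar2020_thm11_selmerDualTorsion_pseudoIso_fineSelmerDual)
    (h714 : thm714_sharpFlatSelmerDual_finite_torsion) :
    ∀ (W : WeierstrassCurve ℚ) [W.IsElliptic] [W.IsGloballyMinimal] (p : ℕ) [Fact p.Prime]
      [ContinuousSMul ℤ_[p] (W.tateModule p)] [Module.Free ℤ_[p] (W.tateModule p)]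
      [Module.Finite ℤ_[p] (W.tateModule p)],
      ClassX8 W p → ∀ (κ : ZpExtension ℚ p) (γ : Field.absoluteGaloisGroup ℚ),
      κ.IsCyclotomic → κ.IsTopGenerator γ → IsCyclotomicVariable p γ →
    ∀ (v : HeightOneSpectrum (𝓞 ℚ)), (p : 𝓞 ℚ) ∈ v.asIdeal →
    ∀ (g : Field.absoluteGaloisGroup (v.adicCompletion ℚ)),
      κ.IsTopGenerator (resGalOfEmb (closureEmb (K := ℚ) (v.adicCompletion ℚ)) g) →
    ∀ (cneg : localPoints W (v.adicCompletion ℚ)) (c : ℕ → localPoints W (v.adicCompletion ℚ)),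
      IsHondaSystem κ (closureEmb (K := ℚ) (v.adicCompletion ℚ)) W (W.frobeniusTrace p) g cneg c →
    ∀ (N : ℕ) (_ : NeZero N) (f : CuspForm (Gamma0 N) 2) (ϖ : ℚ) (Lsharp Lflat : IwasawaAlgebra p),
      IsNewformOf W f → (ϖ : ℝ) * W.realPeriodRat = plusPeriod f →
      IsSprungPair f p (W.frobeniusTrace p) Lsharp Lflat →
    ∀ (I : Kato2004.IwasawaH1Data W p κ γ)
      (Cs : SharpFlatColemanKatoData W p f ϖ κ γ (closureEmb (K := ℚ) (v.adicCompletion ℚ))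
        (W.frobeniusTrace p) g c Chroma.sharp I)
      (Cf : SharpFlatColemanKatoData W p f ϖ κ γ (closureEmb (K := ℚ) (v.adicCompletion ℚ))
        (W.frobeniusTrace p) g c Chroma.flat I),
      Cs.Z = Cf.Z →
    ∀ (Y : W.FineSelmerDualData κ γ) (𝔭 : PrimeSpectrum (IwasawaAlgebra p)), 𝔭.asIdeal.height = 1 →
      (p : IwasawaAlgebra p) ∉ 𝔭.asIdeal → (PowerSeries.X : IwasawaAlgebra p) ∉ 𝔭.asIdeal →
      (∀ (col' : Chroma) (G' : IwasawaAlgebra p),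
        iwasawaToPowerSeries p G' =
          PowerSeries.C (ϖ : ℚ_[p]) * iwasawaToPowerSeries p (chromaticL col' Lsharp Lflat) →
        G' ∈ 𝔭.asIdeal) →
      min (Module.lengthAt (IwasawaAlgebra p) (IwasawaAlgebra p ⧸ LinearMap.range Cs.colMap) 𝔭)
          (Module.lengthAt (IwasawaAlgebra p) (IwasawaAlgebra p ⧸ LinearMap.range Cf.colMap) 𝔭) ≤
        Module.lengthAt (IwasawaAlgebra p) Y.X (PrimeSpectrum.comap (invol p).toRingHom 𝔭) := by
  intro W _ _ p _ _ _ _ hX κ γ hκ hγ hcv v hv g hg cneg c hH N hN f ϖ Lsharp Lflat hnew _hϖ hSP I Cs Cf _hZ Y 𝔭 h𝔭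
    hp𝔭 hT𝔭 _hzero
  haveI := hN
  -- torsion of `X₀` from Thm. 7.14 via `X♯ ↠ X₀`
  have hYt : Module.IsTorsion (IwasawaAlgebra p) Y.X :=
    fineSelmerDualData_isTorsion_of_thm714 h714 W p hX hκ hγ hcv hv hg hH hnew hSP Y
  obtain ⟨Ds⟩ := nonempty_sharpFlatSelmerDualData' W κ (closureEmb (K := ℚ) (v.adicCompletion ℚ))
    (W.frobeniusTrace p) g c Chroma.sharp γ
  obtain ⟨Df⟩ := nonempty_sharpFlatSelmerDualData' W κ (closureEmb (K := ℚ) (v.adicCompletion ℚ))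
    (W.frobeniusTrace p) g c Chroma.flat γ
  have hfin : Module.lengthAt (IwasawaAlgebra p) Y.X 𝔭 ≠ ⊤ := by
    haveI := WeierstrassCurve.FineSelmerDualData.module_finite W κ hγ Y
    exact IwasawaAlgebra.lengthAt_ne_top_of_isTorsion_of_height_le_one p Y.X hYt 𝔭 h𝔭.le
  set S : W.SelmerDualData κ γ := W.selmerDualData κ hγ
  have hM1 := massCotorsion_of_poitouTate hPT h124 Kato2004.nonempty_iwasawaH1Data_holds W p hX κ γ hκ hγ v hv g hg
    cneg c hH S Ds Df Y 𝔭 h𝔭 hp𝔭 hT𝔭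
  have hX' := hX
  obtain ⟨hp3, ⟨hgood, hss⟩, -⟩ := hX'
  subst hp3
  have hM2 : Module.lengthAt (IwasawaAlgebra 3) (Submodule.torsion (IwasawaAlgebra 3) S.X) 𝔭 ≤
      Module.lengthAt (IwasawaAlgebra 3) Y.X (PrimeSpectrum.comap (invol 3).toRingHom 𝔭) :=
    (lengthAt_torsion_selmerDual_eq_fine_comap_invol_of_matar_of_isTorsion hMatar W 3 (by decide) hgood hss hκ hγ S Y
      hYt 𝔭 h𝔭.le).le
  exact min_lengthAt_cokernel_le_of_mass Cs Cf Ds Df Y 𝔭 hfin (hM1.trans (add_le_add le_rfl hM2))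

end Stub

/-! ### §4 (APPEND) The CONTRA (print-keyed, C′) F-α♮ telescope from the same three facts + `h714`

The `γ⁻¹`-keyed twin of §3, for the LEAD's / w3 g9's ι-door in print keying (`…IotaDoorContra.lean`,
`katoFineLowerOffT_of_iotaDoor_contra (hFα′) (hres′)`): packages `Cs Cf : SharpFlatColemanKatoDataContra … I` (p662311), fine datum
`Y′ : W.FineSelmerDualData κ γ⁻¹`, conclusion `min(ℓ_𝔭 Λ/range Cs.colMap, ℓ_𝔭 Λ/range Cf.colMap) ≤ ℓ_{ι𝔭} Y′.X` — the conclusion of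
w2 g9's `cokerBoundIotaOffT_contra_of_poitouTate'` with `Kato2004_fineSelmerDual_isTorsion` replaced by the guard `h714`. -/

section ContraStub

/-- **Contra F-α♮ from THREE outside facts + `h714`**: the conclusion of `cokerBoundIotaOffT_contra_of_poitouTate` /
`cokerBoundIotaOffT_contra_of_massIota` (same binders: class X8, cyclotomic `κ`/`γ`, Honda frame, newform, Sprung pair, `I`,
Contra packages `Cs, Cf` with `Cs.Z = Cf.Z`, `Y′` of key `γ⁻¹`, height-one `𝔭 ∌ p, T`, the common-zero clause), from
`thm714seq_sharpFlat_poitouTate_functionalModel`, `Kato2004.thm12_4`, `matar2020_thm11_selmerDualTorsion_pseudoIso_fineSelmerDual` and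
`thm714_sharpFlatSelmerDual_finite_torsion`. Proof: (M1)-contra = `massCotorsion_contraFamily_of_poitouTate`; (M2)-contra at the instance
through the `γ`-keyed twists (`selmerDualData_exists_involTwist`, §2 at `ι𝔭`, `selmerDualData_lengthAt_torsion_inv_eq`,
`fineSelmerDualData_lengthAt_eq_inv`); `ℓ_𝔭 Y′.X = ℓ_{ι𝔭} Y.X < ⊤` by §1; `min_lengthAt_cokernel_le_of_mass_contra`. -/
theorem cokerBoundIotaOffT_contra_of_poitouTate_of_thm714 (hPT : thm714seq_sharpFlat_poitouTate_functionalModel)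
    (h124 : Kato2004.thm12_4) (hMatar : matar2020_thm11_selmerDualTorsion_pseudoIso_fineSelmerDual)
    (h714 : thm714_sharpFlatSelmerDual_finite_torsion) :
    ∀ (W : WeierstrassCurve ℚ) [W.IsElliptic] [W.IsGloballyMinimal] (p : ℕ) [Fact p.Prime]
      [ContinuousSMul ℤ_[p] (W.tateModule p)] [Module.Free ℤ_[p] (W.tateModule p)]
      [Module.Finite ℤ_[p] (W.tateModule p)],
      ClassX8 W p → ∀ (κ : ZpExtension ℚ p) (γ : Field.absoluteGaloisGroup ℚ),
      κ.IsCyclotomic → κ.IsTopGenerator γ → IsCyclotomicVariable p γ →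
    ∀ (v : HeightOneSpectrum (𝓞 ℚ)), (p : 𝓞 ℚ) ∈ v.asIdeal →
    ∀ (g : Field.absoluteGaloisGroup (v.adicCompletion ℚ)),
      κ.IsTopGenerator (resGalOfEmb (closureEmb (K := ℚ) (v.adicCompletion ℚ)) g) →
    ∀ (cneg : localPoints W (v.adicCompletion ℚ)) (c : ℕ → localPoints W (v.adicCompletion ℚ)),
      IsHondaSystem κ (closureEmb (K := ℚ) (v.adicCompletion ℚ)) W (W.frobeniusTrace p) g cneg c →
    ∀ (N : ℕ) (_ : NeZero N) (f : CuspForm (Gamma0 N) 2) (ϖ : ℚ) (Lsharp Lflat : IwasawaAlgebra p),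
      IsNewformOf W f → (ϖ : ℝ) * W.realPeriodRat = plusPeriod f →
      IsSprungPair f p (W.frobeniusTrace p) Lsharp Lflat →
    ∀ (I : Kato2004.IwasawaH1Data W p κ γ)
      (Cs : SharpFlatColemanKatoDataContra W p f ϖ κ γ (closureEmb (K := ℚ) (v.adicCompletion ℚ))
        (W.frobeniusTrace p) g c Chroma.sharp I)
      (Cf : SharpFlatColemanKatoDataContra W p f ϖ κ γ (closureEmb (K := ℚ) (v.adicCompletion ℚ))
        (W.frobeniusTrace p) g c Chroma.flat I),
      Cs.Z = Cf.Z →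
    ∀ (Y' : W.FineSelmerDualData κ γ⁻¹) (𝔭 : PrimeSpectrum (IwasawaAlgebra p)), 𝔭.asIdeal.height = 1 →
      (p : IwasawaAlgebra p) ∉ 𝔭.asIdeal → (PowerSeries.X : IwasawaAlgebra p) ∉ 𝔭.asIdeal →
      (∀ (col' : Chroma) (G' : IwasawaAlgebra p),
        iwasawaToPowerSeries p G' =
          PowerSeries.C (ϖ : ℚ_[p]) * iwasawaToPowerSeries p (chromaticL col' Lsharp Lflat) →
        G' ∈ 𝔭.asIdeal) →
      min (Module.lengthAt (IwasawaAlgebra p) (IwasawaAlgebra p ⧸ LinearMap.range Cs.colMap) 𝔭)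
          (Module.lengthAt (IwasawaAlgebra p) (IwasawaAlgebra p ⧸ LinearMap.range Cf.colMap) 𝔭) ≤
        Module.lengthAt (IwasawaAlgebra p) Y'.X (PrimeSpectrum.comap (invol p).toRingHom 𝔭) := by
  intro W _ _ p _ _ _ _ hX κ γ hκ hγ hcv v hv g hg cneg c hH N hN f ϖ Lsharp Lflat hnew _hϖ hSP I Cs Cf _hZ Y' 𝔭 h𝔭
    hp𝔭 hT𝔭 _hzero
  haveI := hN
  obtain ⟨Ds'⟩ := nonempty_sharpFlatSelmerDualData' W κ (closureEmb (K := ℚ) (v.adicCompletion ℚ))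
    (W.frobeniusTrace p) g c Chroma.sharp γ⁻¹
  obtain ⟨Df'⟩ := nonempty_sharpFlatSelmerDualData' W κ (closureEmb (K := ℚ) (v.adicCompletion ℚ))
    (W.frobeniusTrace p) g c Chroma.flat γ⁻¹
  -- the `γ`-keyed twist `Y` of `Y'` is torsion (§1), so `ℓ_𝔭 Y'.X = ℓ_{ι𝔭} Y.X < ⊤`
  obtain ⟨Y, -, -, -⟩ := Kato2004.fineSelmerDualData_exists_involTwist (inv_mul_cancel γ) Y'
  have hYt : Module.IsTorsion (IwasawaAlgebra p) Y.X :=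
    fineSelmerDualData_isTorsion_of_thm714 h714 W p hX hκ hγ hcv hv hg hH hnew hSP Y
  have hfin : Module.lengthAt (IwasawaAlgebra p) Y'.X 𝔭 ≠ ⊤ := by
    haveI := WeierstrassCurve.FineSelmerDualData.module_finite W κ hγ Y
    rw [Kato2004.fineSelmerDualData_lengthAt_inv_eq Y Y' 𝔭]
    exact IwasawaAlgebra.lengthAt_ne_top_of_isTorsion_of_height_le_one p Y.X hYt _
      ((Kato2004.height_comap_invol 𝔭).trans h𝔭).le
  -- (M1)-contra from the Poitou–Tate functional model
  obtain ⟨S', -, -, -⟩ := selmerDualData_exists_involTwist (mul_inv_cancel γ) (W.selmerDualData κ hγ)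
  have hM1 := massCotorsion_contraFamily_of_poitouTate hPT h124 Kato2004.nonempty_iwasawaH1Data_holds W p hX κ γ hκ hγ v
    hv g hg cneg c hH S' Ds' Df' Y' 𝔭 h𝔭 hp𝔭 hT𝔭
  -- (M2)-contra at the instance: `ℓ_𝔭 tors S'.X = ℓ_{ι𝔭} tors S.X = ℓ_𝔭 Y.X = ℓ_{ι𝔭} Y'.X` (Matar at `ι𝔭` for the twists)
  have hX' := hX
  obtain ⟨hp3, ⟨hgood, hss⟩, -⟩ := hX'
  subst hp3
  obtain ⟨S, -, -, -⟩ := selmerDualData_exists_involTwist (inv_mul_cancel γ) S'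
  have h1 := lengthAt_torsion_selmerDual_eq_fine_comap_invol_of_matar_of_isTorsion hMatar W 3 (by decide) hgood hss hκ hγ
    S Y hYt (PrimeSpectrum.comap (invol 3).toRingHom 𝔭) (((Kato2004.height_comap_invol 𝔭).trans h𝔭).le)
  rw [Kato2004.comap_invol_comap_invol, ← selmerDualData_lengthAt_torsion_inv_eq S S' 𝔭] at h1
  have hM2 : Module.lengthAt (IwasawaAlgebra 3) (Submodule.torsion (IwasawaAlgebra 3) S'.X) 𝔭 ≤
      Module.lengthAt (IwasawaAlgebra 3) Y'.X (PrimeSpectrum.comap (invol 3).toRingHom 𝔭) :=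
    (h1.trans (Kato2004.fineSelmerDualData_lengthAt_eq_inv Y Y' 𝔭)).le
  exact min_lengthAt_cokernel_le_of_mass_contra Cs Cf Ds' Df' Y' 𝔭 hfin (hM1.trans (add_le_add le_rfl hM2))

end ContraStub

end Summit.BirchSwinnertonDyer.BirchSwinnertonDyer.Theorems.ChromaticCommonZeros

end
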